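import Mathlib
import Summits.KontsevichZagierPeriods.Zeta5Search.ClusterValuation
import Summits.KontsevichZagierPeriods.Zeta5Search.PalindromicClassBounds
import Summits.KontsevichZagierPeriods.Zeta5Search.DenomLaw.ThresholdModelBridgeOctave
import Summits.KontsevichZagierPeriods.Zeta5Search.DenomLaw.ThresholdModelConfigTree

/-!
# ζ(5) search — DENOM-LAW: the threshold model, PART IV (the level configuration of a dominant class), part D: the rung-M/K coefficient rows `wLB/uLB/wLBpal/uLBpal` in closed form; examples

Cell `pub-zeta5`, track DENOM-LAW (K1 typing order item (1), «ThresholdModel port»): denom-engine-d2 g14's kernel-checked scratch module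
`denom-law/engine-d2/g14/lean/LevelCensusConfig.lean` PART IV (THRESHOLD-X6) filed VERBATIM in four parts (≤ 400 lines each; docstrings added
where the scratch file had none) by denom-prover-d1 g5.  Part D of 4.
HONEST FRAMING: systematic search; MODEL/structure side — the level configuration of a dominant class identified with the tree's `classConfig`/`IsPalindromic` and the rung-M/K coefficient rows in closed form; nothing about ζ(5); no γ; no irrationality claim; records in print UNMOVED.
The mathematical header of PART IV is the second module docstring of part A (`ThresholdModelConfig.lean`).
-/

namespace Summit.KontsevichZagierPeriods.Zeta5Search.DenomLaw.ThresholdModel.Rho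

section Config

open Summit.KontsevichZagierPeriods.Zeta5Search.ClusterValuation
  (blockCount netExp classSet classExp CentreIn classPoleCount HasPoleOfOrder classConfig IsPalindromic classBound
    GoodClasses)

/-! ### (X6-6) the tree's PROVED coefficient bounds on a deep cell in closed form: `wLB / uLB` (rung M, `CoefficientClassBounds`)
and `wLBpal / uLBpal` (rung K, `PalindromicClassBounds`, proved in `PalindromicClassBoundsProof`) -/

section CoefficientRows
variable {b : ℕ → ℤ} {p : ℕ} {m u u₀ : ℤ}

open Summit.KontsevichZagierPeriods.Zeta5Search.ClusterValuation (classRowList classRowListPal wLB uLB wLBpal uLBpal)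

/-- `min?` of an integer list with a least element that belongs to it. -/
theorem getD_min_eq {l : List ℤ} {v : ℤ} (hv : v ∈ l) (hle : ∀ z ∈ l, v ≤ z) : (l.min?).getD 0 = v := by
  cases h : l.min? with
  | none => rw [List.min?_eq_none_iff] at h; rw [h] at hv; simp at hv
  | some m' =>
    have h1 := List.min?_eq_some_iff.1 h
    simp only [Option.getD_some]
    exact le_antisymm (h1.2 v hv) (hle m' h1.1)

/-- `E_x` of a dominant class: `score(u) − (4m+8) = δ(u) + [u = 0] − (4m+8)` (`classExp_eq`, `δ_A = δ`, `u ≠ p`). -/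
theorem classExp_of_dominant (hB : BCell (p : ℤ) ((m - 1) * p) (b 0) (lowerB b)) (hm : 1 ≤ m)
    (hd : IsDominant (p : ℤ) (R0b p m (b 0)) (rhob p m (b 0) (lowerB b)) u) {x : ℕ}
    (hx : (p : ℤ) ∣ (x : ℤ) + 1 - tOf p m (b 0) 0 u) :
    classExp b p x = score (p : ℤ) (R0b p m (b 0)) (rhob p m (b 0) (lowerB b)) u - (4 * m + 8) ∧
    classExp b p x = delta (p : ℤ) (R0b p m (b 0)) (rhob p m (b 0) (lowerB b)) u + indic (u = 0) - (4 * m + 8) := by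
  have hD : DeepCell (p : ℤ) (R0b p m (b 0)) (rhob p m (b 0) (lowerB b)) := by
    rw [rhob_eq_rhoOf, R0b_eq_R0Of]; exact hB.deepCell
  have h := hD.levelBox
  have hup := hD.lt_p_of_dominant hd
  obtain ⟨a1, a2, a3, a4⟩ := hD.dominant_admissible hd
  rw [classExp_eq h hm hB.odd_p hd.1.2.2 hd.1.1 hd.1.2.1 hx]
  unfold scoreA score centre
  rw [DeepCell.deltaA_eq_delta a1 a2 a4 a3,
    indic_congr (show (u = 0 ∨ u = (p : ℤ)) ↔ u = 0 from ⟨fun h' => h'.resolve_right (by omega), Or.inl⟩)]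
  exact ⟨rfl, rfl⟩

/-- two dominant classes have the same score. -/
theorem score_eq_of_dominant {p R0 : ℤ} {r : Fin 7 → ℤ} {u v : ℤ} (hu : IsDominant p R0 r u) (hv : IsDominant p R0 r v) :
    score p R0 r u = score p R0 r v :=
  le_antisymm (hu.2 v hv.1) (hv.2 u hu.1)

/-- the multipole row is at least `s + E_x` (definition of `classBound`). -/
theorem le_classBound (b : ℕ → ℤ) {p x : ℕ} (s : ℕ) (h2 : 2 ≤ classPoleCount b p x) :
    (s : ℤ) + classExp b p x ≤ classBound b p x s := by
  unfold classBound; rw [if_pos h2]; split_ifs <;> omega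

/-- **EVERY RESIDUE AGAINST THE DOMINANT LEVEL**: on a deep cell with a dominant class `u₀`, a residue `x` has
`E_x = score(u₀) − (4m+8)` if its class is dominant and `E_x ≥ score(u₀) − (4m+8) + 1` otherwise. -/
theorem classExp_vs_dominant (hB : BCell (p : ℤ) ((m - 1) * p) (b 0) (lowerB b)) (hm : 1 ≤ m)
    (hd₀ : IsDominant (p : ℤ) (R0b p m (b 0)) (rhob p m (b 0) (lowerB b)) u₀) (x : ℕ) :
    (IsDominant (p : ℤ) (R0b p m (b 0)) (rhob p m (b 0) (lowerB b)) (uOf p m (b 0) x) →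
        classExp b p x = score (p : ℤ) (R0b p m (b 0)) (rhob p m (b 0) (lowerB b)) u₀ - (4 * m + 8)) ∧
    (¬ IsDominant (p : ℤ) (R0b p m (b 0)) (rhob p m (b 0) (lowerB b)) (uOf p m (b 0) x) →
        score (p : ℤ) (R0b p m (b 0)) (rhob p m (b 0) (lowerB b)) u₀ - (4 * m + 8) + 1 ≤ classExp b p x) := by
  have hD : DeepCell (p : ℤ) (R0b p m (b 0)) (rhob p m (b 0) (lowerB b)) := by
    rw [rhob_eq_rhoOf, R0b_eq_R0Of]; exact hB.deepCell
  have hp1 : (1 : ℤ) ≤ p := hD.levelBox.one_le_p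
  have hcl := uOf_isClass (m := m) (b0 := b 0) hp1 (x : ℤ)
  have hxu := dvd_uOf (m := m) (b0 := b 0) hp1 (x : ℤ)
  obtain ⟨x₀, -, hx₀⟩ := exists_residue_lt (m := m) (b0 := b 0) hp1 u₀
  have hE₀ := (classExp_of_dominant hB hm hd₀ hx₀).1
  have hmin : ∀ x', classExp b p x₀ ≤ classExp b p x' := (isDominant_iff_classExp_le hB hm hd₀.1 hx₀).1 hd₀
  constructor
  · intro hd
    rw [(classExp_of_dominant hB hm hd hxu).1, score_eq_of_dominant hd hd₀]
  · intro hnd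
    rw [isDominant_iff_classExp_le hB hm hcl hxu] at hnd
    push Not at hnd
    obtain ⟨x', hx'⟩ := hnd
    have := hmin x'
    omega

/-- **RUNG M ON A DEEP CELL**: the row list WITHOUT the bonus (`classRowList b p s`, rows `1` / `s + E_x`; plus the
refund entry `0`) has minimum `s + score(u₀) − (4m+8)` for every `s ≤ 4m + 3` — the dominant rows. -/
theorem minRow_eq (hB : BCell (p : ℤ) ((m - 1) * p) (b 0) (lowerB b)) (hm : 1 ≤ m) {s : ℤ} (hs4 : s ≤ 4 * m + 3)
    (hd₀ : IsDominant (p : ℤ) (R0b p m (b 0)) (rhob p m (b 0) (lowerB b)) u₀) (c : Prop) [Decidable c] :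
    ((classRowList b p s ++ (if c then [0] else [])).min?).getD 0 =
      s + (score (p : ℤ) (R0b p m (b 0)) (rhob p m (b 0) (lowerB b)) u₀ - (4 * m + 8)) := by
  have hD : DeepCell (p : ℤ) (R0b p m (b 0)) (rhob p m (b 0) (lowerB b)) := by
    rw [rhob_eq_rhoOf, R0b_eq_R0Of]; exact hB.deepCell
  have hp1 : (1 : ℤ) ≤ p := hD.levelBox.one_le_p
  have h4 := le_trans (hd₀.2 _ hD.utStar_isClass) hD.score_utStar_le_four
  obtain ⟨x₀, hx₀p, hx₀⟩ := exists_residue_lt (m := m) (b0 := b 0) hp1 u₀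
  have hE₀ := (classExp_of_dominant hB hm hd₀ hx₀).1
  have hpc₀ : 2 ≤ classPoleCount b p x₀ := by have := classPoleCount_of_dominant hB hm hd₀ hx₀; omega
  refine getD_min_eq ?_ ?_
  · refine List.mem_append.2 (Or.inl (List.mem_filterMap.2 ⟨x₀, List.mem_range.2 (by exact_mod_cast hx₀p), ?_⟩))
    rw [if_neg (by omega), if_pos hpc₀, hE₀]
  · intro z hz
    rcases List.mem_append.1 hz with hz | hz
    · obtain ⟨x, hxp, hfx⟩ := List.mem_filterMap.1 hz
      split_ifs at hfx with h1 h2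
      · cases hfx; omega
      · have hzx : z = s + classExp b p x := by cases hfx; rfl
        rw [hzx]
        rcases Classical.em (IsDominant (p : ℤ) (R0b p m (b 0)) (rhob p m (b 0) (lowerB b)) (uOf p m (b 0) x)) with hd | hnd
        · rw [(classExp_vs_dominant hB hm hd₀ x).1 hd]
        · have := (classExp_vs_dominant hB hm hd₀ x).2 hnd; omega
    · have hz0 : z = 0 := by
        split_ifs at hz
        · simpa using hz
        · simp at hz
      omega

/-- **RUNG K ON A DEEP CELL, ALL DOMINANT CLASSES FIRING**: if every dominant class is off-centre and mirror-symmetric, the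
row list WITH the bonus (`classRowListPal b p s`, odd `s ≤ 4m+3`) has minimum `s + score(u₀) − (4m+8) + 1`. -/
theorem minRowPal_eq_of_all (hB : BCell (p : ℤ) ((m - 1) * p) (b 0) (lowerB b)) (hm : 1 ≤ m) {s : ℕ} (hs : Odd s)
    (hs4 : (s : ℤ) ≤ 4 * m + 3) (hd₀ : IsDominant (p : ℤ) (R0b p m (b 0)) (rhob p m (b 0) (lowerB b)) u₀)
    (hall : ∀ v, IsDominant (p : ℤ) (R0b p m (b 0)) (rhob p m (b 0) (lowerB b)) v →
      (v ≠ 0 ∧ L (p : ℤ) (rhob p m (b 0) (lowerB b)) v = R (p : ℤ) (rhob p m (b 0) (lowerB b)) v ∧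
        np (p : ℤ) (R0b p m (b 0)) v = nm (p : ℤ) (R0b p m (b 0)) v))
    (c : Prop) [Decidable c] :
    ((classRowListPal b p s ++ (if c then [0] else [])).min?).getD 0 =
      (s : ℤ) + (score (p : ℤ) (R0b p m (b 0)) (rhob p m (b 0) (lowerB b)) u₀ - (4 * m + 8)) + 1 := by
  have hD : DeepCell (p : ℤ) (R0b p m (b 0)) (rhob p m (b 0) (lowerB b)) := by
    rw [rhob_eq_rhoOf, R0b_eq_R0Of]; exact hB.deepCell
  have hp1 : (1 : ℤ) ≤ p := hD.levelBox.one_le_p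
  have h4 := le_trans (hd₀.2 _ hD.utStar_isClass) hD.score_utStar_le_four
  -- the row of a dominant class `v` with residue `x`: `s + E_x + 1`
  have rowdom : ∀ {v : ℤ} {x : ℕ}, IsDominant (p : ℤ) (R0b p m (b 0)) (rhob p m (b 0) (lowerB b)) v →
      (p : ℤ) ∣ (x : ℤ) + 1 - tOf p m (b 0) 0 v →
      classBound b p x s = (s : ℤ) + (score (p : ℤ) (R0b p m (b 0)) (rhob p m (b 0) (lowerB b)) u₀ - (4 * m + 8)) + 1 := by
    intro v x hd hx
    obtain ⟨hv0, hLR, hnn⟩ := hall v hd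
    rw [classBound_of_dominant_ne_zero_odd hB hm hd hx hs hv0, indic_pos ⟨hLR, hnn⟩, ← score_eq_of_dominant hd hd₀]
    unfold score centre
    rw [indic_neg (fun h' => h'.elim hv0 (fun e => absurd e (ne_of_lt (hD.lt_p_of_dominant hd))))]
    ring
  obtain ⟨x₀, hx₀p, hx₀⟩ := exists_residue_lt (m := m) (b0 := b 0) hp1 u₀
  have hpc₀ : 2 ≤ classPoleCount b p x₀ := by have := classPoleCount_of_dominant hB hm hd₀ hx₀; omega
  refine getD_min_eq ?_ ?_
  · refine List.mem_append.2 (Or.inl (List.mem_filterMap.2 ⟨x₀, List.mem_range.2 (by exact_mod_cast hx₀p), ?_⟩))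
    rw [if_neg (by omega), if_pos hpc₀, rowdom hd₀ hx₀]
  · intro z hz
    rcases List.mem_append.1 hz with hz | hz
    · obtain ⟨x, hxp, hfx⟩ := List.mem_filterMap.1 hz
      split_ifs at hfx with h1 h2
      · cases hfx; omega
      · have hzx : z = classBound b p x s := by cases hfx; rfl
        rw [hzx]
        rcases Classical.em (IsDominant (p : ℤ) (R0b p m (b 0)) (rhob p m (b 0) (lowerB b)) (uOf p m (b 0) x)) with hd | hnd
        · rw [rowdom hd (dvd_uOf (m := m) (b0 := b 0) hp1 (x : ℤ))]
        · have := (classExp_vs_dominant hB hm hd₀ x).2 hnd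
          have := le_classBound b s h2
          omega
    · have hz0 : z = 0 := by
        split_ifs at hz
        · simpa using hz
        · simp at hz
      omega

/-- **RUNG K ON A DEEP CELL, SOME DOMINANT CLASS NOT FIRING** (the centre class is dominant, or a dominant root type is not
mirror-symmetric): the row list with the bonus has the SAME minimum as without it, `s + score(u₁) − (4m+8)`. -/
theorem minRowPal_eq_of_not (hB : BCell (p : ℤ) ((m - 1) * p) (b 0) (lowerB b)) (hm : 1 ≤ m) {s : ℕ} (hs : Odd s)
    (hs4 : (s : ℤ) ≤ 4 * m + 3) {u₁ : ℤ} (hd₁ : IsDominant (p : ℤ) (R0b p m (b 0)) (rhob p m (b 0) (lowerB b)) u₁)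
    (hno : ¬ (u₁ ≠ 0 ∧ L (p : ℤ) (rhob p m (b 0) (lowerB b)) u₁ = R (p : ℤ) (rhob p m (b 0) (lowerB b)) u₁ ∧
        np (p : ℤ) (R0b p m (b 0)) u₁ = nm (p : ℤ) (R0b p m (b 0)) u₁))
    (c : Prop) [Decidable c] :
    ((classRowListPal b p s ++ (if c then [0] else [])).min?).getD 0 =
      (s : ℤ) + (score (p : ℤ) (R0b p m (b 0)) (rhob p m (b 0) (lowerB b)) u₁ - (4 * m + 8)) := by
  have hD : DeepCell (p : ℤ) (R0b p m (b 0)) (rhob p m (b 0) (lowerB b)) := by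
    rw [rhob_eq_rhoOf, R0b_eq_R0Of]; exact hB.deepCell
  have hp1 : (1 : ℤ) ≤ p := hD.levelBox.one_le_p
  have h4 := le_trans (hd₁.2 _ hD.utStar_isClass) hD.score_utStar_le_four
  obtain ⟨x₁, hx₁p, hx₁⟩ := exists_residue_lt (m := m) (b0 := b 0) hp1 u₁
  have hpc₁ : 2 ≤ classPoleCount b p x₁ := by have := classPoleCount_of_dominant hB hm hd₁ hx₁; omega
  have hE₁ := (classExp_of_dominant hB hm hd₁ hx₁).1
  -- the row of `u₁` carries no bonus
  have row₁ : classBound b p x₁ s = (s : ℤ) + (score (p : ℤ) (R0b p m (b 0)) (rhob p m (b 0) (lowerB b)) u₁ - (4 * m + 8)) := by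
    rw [classBound_of_dominant_odd hB hm hd₁ hx₁ hs, indic_neg hno]
    unfold score centre
    rw [indic_congr (show (u₁ = 0 ∨ u₁ = (p : ℤ)) ↔ u₁ = 0 from
      ⟨fun h' => h'.resolve_right (ne_of_lt (hD.lt_p_of_dominant hd₁)), Or.inl⟩)]
    ring
  refine getD_min_eq ?_ ?_
  · refine List.mem_append.2 (Or.inl (List.mem_filterMap.2 ⟨x₁, List.mem_range.2 (by exact_mod_cast hx₁p), ?_⟩))
    rw [if_neg (by omega), if_pos hpc₁, row₁]
  · intro z hz
    rcases List.mem_append.1 hz with hz | hz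
    · obtain ⟨x, hxp, hfx⟩ := List.mem_filterMap.1 hz
      split_ifs at hfx with h1 h2
      · cases hfx; omega
      · have hzx : z = classBound b p x s := by cases hfx; rfl
        rw [hzx]
        have := le_classBound b s h2
        rcases Classical.em (IsDominant (p : ℤ) (R0b p m (b 0)) (rhob p m (b 0) (lowerB b)) (uOf p m (b 0) x)) with hd | hnd
        · have := (classExp_vs_dominant hB hm hd₁ x).1 hd; omega
        · have := (classExp_vs_dominant hB hm hd₁ x).2 hnd; omega
    · have hz0 : z = 0 := by
        split_ifs at hz
        · simpa using hz
        · simp at hz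
      omega

/-- **THE TREE'S `W`-BOUNDS ON A DEEP CELL IN CLOSED FORM** (rung M: `wLB_le_padicValRat_coeffW`; rung K:
`palindromicClassBoundW_holds`): `wLB b p = 3 + score(u₀) − (4m+8)` for any dominant `u₀`, and
`wLBpal b p = wLB b p + [every dominant class u has u ≠ 0 ∧ L(u) = R(u) ∧ n₊(u) = n₋(u)]` (two cases). -/
theorem wLB_of_deep (hB : BCell (p : ℤ) ((m - 1) * p) (b 0) (lowerB b)) (hm : 1 ≤ m)
    (hd₀ : IsDominant (p : ℤ) (R0b p m (b 0)) (rhob p m (b 0) (lowerB b)) u₀) :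
    wLB b p = 3 + (score (p : ℤ) (R0b p m (b 0)) (rhob p m (b 0) (lowerB b)) u₀ - (4 * m + 8)) := by
  unfold wLB; exact minRow_eq hB hm (by omega) hd₀ _

/-- `wLBpal` on a deep cell when every dominant class is palindromic. -/
theorem wLBpal_of_deep_all (hB : BCell (p : ℤ) ((m - 1) * p) (b 0) (lowerB b)) (hm : 1 ≤ m)
    (hd₀ : IsDominant (p : ℤ) (R0b p m (b 0)) (rhob p m (b 0) (lowerB b)) u₀)
    (hall : ∀ v, IsDominant (p : ℤ) (R0b p m (b 0)) (rhob p m (b 0) (lowerB b)) v →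
      (v ≠ 0 ∧ L (p : ℤ) (rhob p m (b 0) (lowerB b)) v = R (p : ℤ) (rhob p m (b 0) (lowerB b)) v ∧
        np (p : ℤ) (R0b p m (b 0)) v = nm (p : ℤ) (R0b p m (b 0)) v)) :
    wLBpal b p = 3 + (score (p : ℤ) (R0b p m (b 0)) (rhob p m (b 0) (lowerB b)) u₀ - (4 * m + 8)) + 1 := by
  unfold wLBpal; exact minRowPal_eq_of_all hB hm (by decide) (by omega) hd₀ hall _

/-- `wLBpal` on a deep cell when some dominant class is not palindromic. -/
theorem wLBpal_of_deep_not (hB : BCell (p : ℤ) ((m - 1) * p) (b 0) (lowerB b)) (hm : 1 ≤ m) {u₁ : ℤ}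
    (hd₁ : IsDominant (p : ℤ) (R0b p m (b 0)) (rhob p m (b 0) (lowerB b)) u₁)
    (hno : ¬ (u₁ ≠ 0 ∧ L (p : ℤ) (rhob p m (b 0) (lowerB b)) u₁ = R (p : ℤ) (rhob p m (b 0) (lowerB b)) u₁ ∧
        np (p : ℤ) (R0b p m (b 0)) u₁ = nm (p : ℤ) (R0b p m (b 0)) u₁)) :
    wLBpal b p = 3 + (score (p : ℤ) (R0b p m (b 0)) (rhob p m (b 0) (lowerB b)) u₁ - (4 * m + 8)) := by
  unfold wLBpal; exact minRowPal_eq_of_not hB hm (by decide) (by omega) hd₁ hno _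

/-- **THE TREE'S `U`-BOUNDS ON A DEEP CELL IN CLOSED FORM** (rung M: `uLB_le_padicValRat_coeffU`; rung K:
`palindromicClassBoundU_holds`): `uLB b p = 5 + score(u₀) − (4m+8)`, `uLBpal = uLB + [every dominant class fires]`. -/
theorem uLB_of_deep (hB : BCell (p : ℤ) ((m - 1) * p) (b 0) (lowerB b)) (hm : 1 ≤ m)
    (hd₀ : IsDominant (p : ℤ) (R0b p m (b 0)) (rhob p m (b 0) (lowerB b)) u₀) :
    uLB b p = 5 + (score (p : ℤ) (R0b p m (b 0)) (rhob p m (b 0) (lowerB b)) u₀ - (4 * m + 8)) := by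
  unfold uLB; exact minRow_eq hB hm (by omega) hd₀ _

/-- `uLBpal` on a deep cell when every dominant class is palindromic. -/
theorem uLBpal_of_deep_all (hB : BCell (p : ℤ) ((m - 1) * p) (b 0) (lowerB b)) (hm : 1 ≤ m)
    (hd₀ : IsDominant (p : ℤ) (R0b p m (b 0)) (rhob p m (b 0) (lowerB b)) u₀)
    (hall : ∀ v, IsDominant (p : ℤ) (R0b p m (b 0)) (rhob p m (b 0) (lowerB b)) v →
      (v ≠ 0 ∧ L (p : ℤ) (rhob p m (b 0) (lowerB b)) v = R (p : ℤ) (rhob p m (b 0) (lowerB b)) v ∧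
        np (p : ℤ) (R0b p m (b 0)) v = nm (p : ℤ) (R0b p m (b 0)) v)) :
    uLBpal b p = 5 + (score (p : ℤ) (R0b p m (b 0)) (rhob p m (b 0) (lowerB b)) u₀ - (4 * m + 8)) + 1 := by
  unfold uLBpal; exact minRowPal_eq_of_all hB hm (by decide) (by omega) hd₀ hall _

/-- `uLBpal` on a deep cell when some dominant class is not palindromic. -/
theorem uLBpal_of_deep_not (hB : BCell (p : ℤ) ((m - 1) * p) (b 0) (lowerB b)) (hm : 1 ≤ m) {u₁ : ℤ}
    (hd₁ : IsDominant (p : ℤ) (R0b p m (b 0)) (rhob p m (b 0) (lowerB b)) u₁)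
    (hno : ¬ (u₁ ≠ 0 ∧ L (p : ℤ) (rhob p m (b 0) (lowerB b)) u₁ = R (p : ℤ) (rhob p m (b 0) (lowerB b)) u₁ ∧
        np (p : ℤ) (R0b p m (b 0)) u₁ = nm (p : ℤ) (R0b p m (b 0)) u₁)) :
    uLBpal b p = 5 + (score (p : ℤ) (R0b p m (b 0)) (rhob p m (b 0) (lowerB b)) u₁ - (4 * m + 8)) := by
  unfold uLBpal; exact minRowPal_eq_of_not hB hm (by decide) (by omega) hd₁ hno _

end CoefficientRows

/-! ### Kernel examples: configurations of dominant classes on three (1,11) cells, by `decide` on the tree's definitions -/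

section ConfigExamples

open Summit.KontsevichZagierPeriods.Zeta5Search.ClusterValuation (wLB uLB wLBpal uLBpal)

/-- the (1,11) cell `(30; 12,9,9,7,7,7,7)`: `ρ = (6,12,12,16,16,16,16)`, `R₀ = 19`; its dominant classes are `u = ±1`
(`δ = 2` minimal), of root type `L = R = 1`, `n₊ = n₋ = 0` — mirror-symmetric. -/
def palCell : ℕ → ℤ := fun i => [30, 12, 9, 9, 7, 7, 7, 7].getD i 0

/-- model side: `ρ`, `R₀`; the residue `x = 9` has class offset `u = 1`; its root type; `u = 1` is dominant. -/
example : rhob 11 1 (palCell 0) (lowerB palCell) = ![6, 12, 12, 16, 16, 16, 16] ∧ R0b 11 1 (palCell 0) = 19 ∧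
    uOf 11 1 30 9 = 1 ∧ L 11 ![6, 12, 12, 16, 16, 16, 16] 1 = 1 ∧ R 11 ![6, 12, 12, 16, 16, 16, 16] 1 = 1 ∧
    np 11 19 1 = 0 ∧ nm 11 19 1 = 0 ∧
    (∀ u ∈ Finset.Ioc (-11 : ℤ) 11, (u - 19) % 2 = 0 →
      score 11 19 ![6, 12, 12, 16, 16, 16, 16] 1 ≤ score 11 19 ![6, 12, 12, 16, 16, 16, 16] u) := by
  refine ⟨?_, by decide, by decide, by decide, by decide, by decide, by decide, by decide⟩
  funext j; fin_cases j <;> decide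

/-- tree side: the configuration of `x = 9` is `{(18, −5), (40, −5)}` (positions 9 and 20, both of net exponent
`−5 = L − 6 = R − 6`), PALINDROMIC (`M = 58 = 2b₀ − 2u`); `E_x = −10`, two poles, and at `s = 3` and `s = 5` the bonus
FIRES: `classBound = 3 − 10 + 1 = −6`, `5 − 10 + 1 = −4`. -/
example : classConfig palCell 11 9 = {(18, -5), (40, -5)} ∧ IsPalindromic (classConfig palCell 11 9) ∧
    classExp palCell 11 9 = -10 ∧ classPoleCount palCell 11 9 = 2 ∧ classBound palCell 11 9 3 = -6 ∧
    classBound palCell 11 9 5 = -4 := by decide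

/-- coefficient level on the same cell: BOTH dominant classes `u = ±1` are off-centre and mirror-symmetric, so rung K lifts
the proved `W`/`U` bounds of the tree by one: `wLB = 3 − 10 = −7`, `wLBpal = −6`; `uLB = −5`, `uLBpal = −4`. -/
example : wLB palCell 11 = -7 ∧ wLBpal palCell 11 = -6 ∧ uLB palCell 11 = -5 ∧ uLBpal palCell 11 = -4 := by decide

/-- the (1,11) cell `(31; 13,10,10,7,7,7,7)` (`b₀` odd): `ρ = (5,11,11,17,17,17,17)`, `R₀ = 20`; its single dominant
class is the centre class `u = 0` (residue `x = 10`), `L = R = 1`: the configuration `{(20,−5), (31,1), (42,−5)}`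
carries the ODD CENTRE `(31, 1)` and is palindromic, but `3 + E_x = 3 − 9` is even: NO bonus, `classBound = −6`. -/
def cenCell : ℕ → ℤ := fun i => [31, 13, 10, 10, 7, 7, 7, 7].getD i 0

example : uOf 11 1 31 10 = 0 ∧ classConfig cenCell 11 10 = {(20, -5), (31, 1), (42, -5)} ∧
    IsPalindromic (classConfig cenCell 11 10) ∧ classExp cenCell 11 10 = -9 ∧ classBound cenCell 11 10 3 = -6 := by
  decide

/-- the standing cell `exCell = (28; 10,9,9,8,7,7,7)` of Parts I–III: its dominant class `u = 1` (residue `x = 8`) has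
`L = 3 ≠ R = 1`: configuration `{(16,−3), (38,−5)}`, NOT palindromic, `classBound(3) = 3 − 8 = −5`; a pole of order
`5 = 6 − R`, none of order `6`. -/
example : classConfig exCell 11 8 = {(16, -3), (38, -5)} ∧ ¬ IsPalindromic (classConfig exCell 11 8) ∧
    classBound exCell 11 8 3 = -5 ∧ HasPoleOfOrder exCell 11 8 5 ∧ ¬ HasPoleOfOrder exCell 11 8 6 := by decide

end ConfigExamples

end Config

end Summit.KontsevichZagierPeriods.Zeta5Search.DenomLaw.ThresholdModel.Rho
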